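import Literature.NumberTheory.Automorphic.AutomorphicQuotientKernelCompact
import HarnessLib

/-!
# The automorphic kernel is linear in the test function; the diagonal `x ↦ K_F(x, x)` on a compact quotient
(Gelfand–Graev–Piatetski-Shapiro (1969), Ch. 1 §2: the kernel `K(x, y) = Σ_γ f(x⁻¹ γ y)`; Gelbart (1975), (9.11))

Topic `NumberTheory/Automorphic`; namespace `Literature.NumberTheory.Automorphic` (dot notation on `AdelicGroupData`).
Theorems only — no definition, no named fact, no `sorry`, no instance or instance attribute. Continuation of
`AutomorphicQuotientKernel` / `AutomorphicQuotientKernelCompact` (the kernel `cosetKernel` / `quotientKernel` of `R(f)`),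
supplying what the DIAGONAL TRACE FUNCTIONAL `F ↦ c⁻¹ ∫_X K_F(x, x) dμ` (`AutomorphicQuotientDiagonalTrace`) needs to be a
`ℂ`-linear map:

* (private) `integrable_comp_mul_inv_coe_mul_inv` — the integrand `h ↦ f(x̃ h⁻¹ ỹ⁻¹)` on a closed subgroup `Γ` is integrable for
  `f ∈ C_c(G)`;
* `quotientKernel_add`, `quotientKernel_const_smul` (private lifts `cosetKernel_add`, `cosetKernel_const_smul`) — for a closed
  (unimodular) `Γ ≤ G` the kernel `K_f(x̃, ỹΓ) = ∫_Γ f(x̃ h⁻¹ ỹ⁻¹) dρ(h)` is ADDITIVE and HOMOGENEOUS in `f ∈ C_c(G)`;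
* `AdelicGroupData.integrable_quotientKernel_diag` — on a COMPACT automorphic quotient the diagonal `x ↦ K_F(x, x)` of
  `F ∈ C_c(G(𝔸_K))` is `μ`-integrable (continuous and bounded, finite measure);
* `AdelicGroupData.integral_quotientKernel_diag_add`, `…_smul` — `F ↦ ∫_X K_F(x, x) dμ` is additive and homogeneous.

The automorphic quotient carries the tree's Borel structure keyed on the syntactic form `G(𝔸_K) ⧸ (A_G · G(K))`
(`AdelicGroupData.measurableSpaceQuotientForm`, `…borelSpaceQuotientForm` of `AutomorphicQuotientKernel`); it is INLINED
in the statements by term-mode `letI`/`haveI` (no `attribute [local instance]`), so the statements elaborate to the same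
terms as those of the kernel files.

## References

* I. M. Gelfand, M. I. Graev, I. I. Piatetski-Shapiro, *Representation theory and automorphic functions* (1969),
  Ch. 1 §2 [GelfandGraevPiatetskiShapiro1969].
* S. Gelbart, *Automorphic forms on adele groups*, Ann. of Math. Studies 83 (1975), (9.11) [Gelbart1975].
-/

noncomputable section

open MeasureTheory Measure Set Filter Topology CompactlySupported NumberField
open Literature.MeasureTheory.Group
open scoped ENNReal NNReal

namespace Literature.NumberTheory.Automorphic

/-! ### Linearity of the automorphic kernel in the test function (closed unimodular `Γ ≤ G`) -/

section Integrand

variable {G : Type*} [Group G] [TopologicalSpace G] [IsTopologicalGroup G] [MeasurableSpace G] [BorelSpace G]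
  (Γ : Subgroup G) [hΓ : IsClosed (Γ : Set G)] (ρ : Measure Γ) [IsFiniteMeasureOnCompacts ρ]
  {𝕜 : Type*} [RCLike 𝕜]

/-- The integrand `h ↦ f(x̃ h⁻¹ ỹ⁻¹)` of the automorphic kernel `K_f(x̃, ỹΓ) = ∫_Γ f(x̃ h⁻¹ ỹ⁻¹) dρ(h)` is
`ρ`-integrable for `f ∈ C_c(G)` and a closed subgroup `Γ` (it is `f` composed with the closed embedding
`h ↦ x̃ h⁻¹ ỹ⁻¹ : Γ → G`, hence continuous with compact support; `ρ` is finite on compact sets). [folklore] -/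
private theorem integrable_comp_mul_inv_coe_mul_inv {f : G → 𝕜} (hf : Continuous f) (hfs : HasCompactSupport f)
    (x₀ y₀ : G) : Integrable (fun h : Γ => f (x₀ * (h : G)⁻¹ * y₀⁻¹)) ρ := by
  have hφ : IsClosedEmbedding (fun h : Γ => x₀ * (h : G)⁻¹ * y₀⁻¹) :=
    (Homeomorph.mulRight y₀⁻¹).isClosedEmbedding.comp ((Homeomorph.mulLeft x₀).isClosedEmbedding.comp
      ((Homeomorph.inv G).isClosedEmbedding.comp hΓ.isClosedEmbedding_subtypeVal))
  exact (hf.comp hφ.continuous).integrable_of_hasCompactSupport (hfs.comp_isClosedEmbedding hφ)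

end Integrand

section KernelLinearity

variable {G : Type*} [Group G] [TopologicalSpace G] [IsTopologicalGroup G] [LocallyCompactSpace G]
  [SecondCountableTopology G] [T2Space G] [MeasurableSpace G] [BorelSpace G]
  (Γ : Subgroup G) [hΓ : IsClosed (Γ : Set G)]
  (ρ : Measure Γ) [ρ.IsMulLeftInvariant] [SFinite ρ] [IsFiniteMeasureOnCompacts ρ]
  [MeasurableSpace (G ⧸ Γ)] [BorelSpace (G ⧸ Γ)]
  {𝕜 : Type*} [RCLike 𝕜]

/-- **The automorphic kernel is additive in the test function** (as a function of a lift of the first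
variable): `K_{f+g}(x̃, y) = K_f(x̃, y) + K_g(x̃, y)` for `f, g ∈ C_c(G)`. [folklore] -/
private theorem cosetKernel_add {f g : G → 𝕜} (hf : Continuous f) (hfs : HasCompactSupport f) (hg : Continuous g)
    (hgs : HasCompactSupport g) (x₀ : G) (y : G ⧸ Γ) :
    cosetKernel Γ ρ (f + g) x₀ y = cosetKernel Γ ρ f x₀ y + cosetKernel Γ ρ g x₀ y := by
  induction y using QuotientGroup.induction_on with
  | H y₀ =>
    rw [cosetKernel_mk, cosetKernel_mk, cosetKernel_mk, ← integral_add
      (integrable_comp_mul_inv_coe_mul_inv Γ ρ hf hfs x₀ y₀)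
      (integrable_comp_mul_inv_coe_mul_inv Γ ρ hg hgs x₀ y₀)]
    rfl

omit [IsFiniteMeasureOnCompacts ρ] in
/-- **The automorphic kernel is homogeneous in the test function**: `K_{a f}(x̃, y) = a K_f(x̃, y)`.
[folklore] -/
private theorem cosetKernel_const_smul (a : 𝕜) (f : G → 𝕜) (x₀ : G) (y : G ⧸ Γ) :
    cosetKernel Γ ρ (a • f) x₀ y = a * cosetKernel Γ ρ f x₀ y := by
  induction y using QuotientGroup.induction_on with
  | H y₀ =>
    rw [cosetKernel_mk, cosetKernel_mk, ← integral_const_mul]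
    rfl

variable [ρ.IsMulRightInvariant]

/-- **Additivity of the kernel on `(G ⧸ Γ) × (G ⧸ Γ)`** (unimodular `Γ`): `K_{f+g} = K_f + K_g` for
`f, g ∈ C_c(G)` — Gelfand–Graev–Piatetski-Shapiro's `K(x, y) = Σ_γ f(x⁻¹ γ y)` is linear in `f`.
[cite: GelfandGraevPiatetskiShapiro1969, Ch. 1 §2] -/
theorem quotientKernel_add {f g : G → 𝕜} (hf : Continuous f) (hfs : HasCompactSupport f) (hg : Continuous g)
    (hgs : HasCompactSupport g) (x y : G ⧸ Γ) :
    quotientKernel Γ ρ (f + g) x y = quotientKernel Γ ρ f x y + quotientKernel Γ ρ g x y := by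
  induction x using QuotientGroup.induction_on with
  | H x₀ =>
    rw [quotientKernel_mk, quotientKernel_mk, quotientKernel_mk]
    exact cosetKernel_add Γ ρ hf hfs hg hgs x₀ y

omit [IsFiniteMeasureOnCompacts ρ] in
/-- **Homogeneity of the kernel on `(G ⧸ Γ) × (G ⧸ Γ)`**: `K_{a f} = a K_f`.
[cite: GelfandGraevPiatetskiShapiro1969, Ch. 1 §2] -/
theorem quotientKernel_const_smul (a : 𝕜) (f : G → 𝕜) (x y : G ⧸ Γ) :
    quotientKernel Γ ρ (a • f) x y = a * quotientKernel Γ ρ f x y := by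
  induction x using QuotientGroup.induction_on with
  | H x₀ =>
    rw [quotientKernel_mk, quotientKernel_mk]
    exact cosetKernel_const_smul Γ ρ a f x₀ y

end KernelLinearity

/-! ### The diagonal trace functional of an adelic group datum with compact automorphic quotient -/

namespace AdelicGroupData

universe u

variable {K : Type} [Field K] [NumberField K] (𝒢 : AdelicGroupData.{u} K)
  (μ : Measure 𝒢.automorphicQuotient) [𝒢.IsAutomorphicMeasure μ]
  [LocallyCompactSpace 𝒢.Adelic] [SecondCountableTopology 𝒢.Adelic] [T2Space 𝒢.Adelic]
  [MeasurableSpace 𝒢.Adelic] [BorelSpace 𝒢.Adelic]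
  [hH : IsClosed (𝒢.quotientSubgroup : Set 𝒢.Adelic)]
  (ρ : Measure 𝒢.quotientSubgroup) [ρ.IsMulLeftInvariant] [ρ.IsMulRightInvariant]
  [IsFiniteMeasureOnCompacts ρ] [SFinite ρ]

/-- **The diagonal `x ↦ K_F(x, x)` of the kernel of `F ∈ C_c(G(𝔸_K))` is `μ`-integrable on a compact
automorphic quotient** (continuous, `stronglyMeasurable_uncurry_quotientKernel`, and bounded,
`exists_norm_quotientKernel_le'`, on a space of finite measure). [cite: Gelbart1975, (9.11)] -/
theorem integrable_quotientKernel_diag [CompactSpace 𝒢.automorphicQuotient] (F : C_c(𝒢.Adelic, ℂ)) :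
    (letI := measurableSpaceQuotientForm 𝒢
    haveI := borelSpaceQuotientForm 𝒢
    Integrable (fun x : 𝒢.automorphicQuotient => quotientKernel 𝒢.quotientSubgroup ρ F x x) μ) := by
  letI := measurableSpaceQuotientForm 𝒢
  haveI := borelSpaceQuotientForm 𝒢
  obtain ⟨C, hC⟩ := exists_norm_quotientKernel_le' 𝒢 ρ F
  have hK := stronglyMeasurable_uncurry_quotientKernel 𝒢 ρ F
  have hm : AEStronglyMeasurable
      (fun x : 𝒢.automorphicQuotient => quotientKernel 𝒢.quotientSubgroup ρ F x x) μ :=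
    (hK.comp_measurable (measurable_id.prodMk measurable_id)).aestronglyMeasurable
  exact (integrable_const C).mono' hm (Eventually.of_forall fun x => hC x x)

/-- **`F ↦ ∫_X K_F(x, x) dμ` is additive** on `C_c(G(𝔸_K), ℂ)` (compact quotient).
[cite: GelfandGraevPiatetskiShapiro1969, Ch. 1 §2] -/
theorem integral_quotientKernel_diag_add [CompactSpace 𝒢.automorphicQuotient] (F G : C_c(𝒢.Adelic, ℂ)) :
    (letI := measurableSpaceQuotientForm 𝒢
    haveI := borelSpaceQuotientForm 𝒢
    ∫ x, quotientKernel 𝒢.quotientSubgroup ρ (⇑(F + G)) x x ∂μ =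
      ∫ x, quotientKernel 𝒢.quotientSubgroup ρ F x x ∂μ + ∫ x, quotientKernel 𝒢.quotientSubgroup ρ G x x ∂μ) := by
  letI := measurableSpaceQuotientForm 𝒢
  haveI := borelSpaceQuotientForm 𝒢
  refine (integral_congr_ae (Eventually.of_forall fun x => ?_)).trans
    (integral_add (integrable_quotientKernel_diag 𝒢 μ ρ F) (integrable_quotientKernel_diag 𝒢 μ ρ G))
  change quotientKernel 𝒢.quotientSubgroup ρ (⇑(F + G)) x x =
    quotientKernel 𝒢.quotientSubgroup ρ F x x + quotientKernel 𝒢.quotientSubgroup ρ G x x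
  rw [CompactlySupportedContinuousMap.coe_add]
  exact quotientKernel_add 𝒢.quotientSubgroup ρ F.continuous F.hasCompactSupport G.continuous
    G.hasCompactSupport x x

omit [𝒢.IsAutomorphicMeasure μ] [IsFiniteMeasureOnCompacts ρ] in
/-- **`F ↦ ∫_X K_F(x, x) dμ` is homogeneous**: `∫ K_{aF}(x, x) dμ = a ∫ K_F(x, x) dμ`.
[cite: GelfandGraevPiatetskiShapiro1969, Ch. 1 §2] -/
theorem integral_quotientKernel_diag_smul (a : ℂ) (F : C_c(𝒢.Adelic, ℂ)) :
    (letI := measurableSpaceQuotientForm 𝒢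
    haveI := borelSpaceQuotientForm 𝒢
    ∫ x, quotientKernel 𝒢.quotientSubgroup ρ (⇑(a • F)) x x ∂μ =
      a * ∫ x, quotientKernel 𝒢.quotientSubgroup ρ F x x ∂μ) := by
  letI := measurableSpaceQuotientForm 𝒢
  haveI := borelSpaceQuotientForm 𝒢
  refine (integral_congr_ae (Eventually.of_forall fun x => ?_)).trans
    (integral_const_mul a fun x => quotientKernel 𝒢.quotientSubgroup ρ F x x)
  change quotientKernel 𝒢.quotientSubgroup ρ (⇑(a • F)) x x = a * quotientKernel 𝒢.quotientSubgroup ρ F x x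
  rw [CompactlySupportedContinuousMap.coe_smul]
  exact quotientKernel_const_smul 𝒢.quotientSubgroup ρ a (⇑F) x x

end AdelicGroupData

end Literature.NumberTheory.Automorphic
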